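import Mathlib
import HarnessLib
import Literature.Analysis.FluidPDE.MildBoundedAncientPressureBMO
import Summits.NavierStokesRegularity.NavierStokesRegularity.Theorems.PoloidalWindowDoorLrcModEntireTwistingTHFlatSlicePressure

/-!
# Item `LrcModEntire` (stmt-NavierStokesRegularity-20428), skeleton twist_split v6 — cell T1 of the (TH) column, STEP (II) CLOSED MODULO ONE PUBLISHED FACT:
# **no flat hot slice** — `v₂(−1,·) ≡ v₂(−1,0) ≠ 0` is impossible in the class, given the logarithmic growth of the mild pressure

Cell ns-regularity-ideate, LEAD ns-poloidal-K2-p3 g13 (`--supports stmt-NavierStokesRegularity-20428`; CELLS-TH-g13 §2bis).  By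
`…TwistingTHFlatSlicePressure.exists_linearPressure_of_flatSlice` (p694661) a flat hot slice forces `(∇P(−1,·))(x)₂ = −N/2` at every `x`, i.e. the pressure
slice drops LINEARLY along every vertical line: `P(−1, R e₂) − P(−1, 0) = −N R/2`.  For a mild bounded ancient solution the pressure is
`p_{u⊗u} ∈ L∞(−∞,0; BMO(ℝ³))` with bounded gradient (Koch–Nadirashvili–Seregin–Šverák 2009 §4; Seregin 2014, Def. 6.3, Prop. 3.9, Remarks 6.2–6.4: the linear
pressures `b′(t)·x` are exactly what mildness excludes), whence `|p(t,x) − p(t,0)| ≤ K_t (1 + log(1 + |x|))` — the NAMED FACT `Literature.Analysis.FluidPDE.MildAncientPressureLogGrowth`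
(unproved in the tree: it makes `false_of_flatSlice` CONDITIONAL — the gate records a conditional result).

* the fact (F2) of CELLS-TH-g13 §2bis is `Literature.Analysis.FluidPDE.MildAncientPressureLogGrowth` (`Literature/Analysis/FluidPDE/MildBoundedAncientPressureBMO.lean`);
* `apply_sub_apply_of_gradient_two` — `(∇f(y))₂ = c` for all `y` ⇒ `f(R e₂) − f(0) = c R`;
* `false_of_flatSlice` — **(F2) ∧ class ∧ hot-spot normalisation ∧ flat slice `v₂(−1,·) ≡ v₂(−1,0)` ⇒ False.**

WHAT THIS IS NOT: not a claim about Navier–Stokes regularity; T1 needs in addition step (I) («flat thread PLANE ⇒ flat SLICE», CELLS-TH-g13 §2bis) and stays OPEN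
(bears_on LADDER-NS N0, item 20428 / crux 19708).
-/

noncomputable section

-- the summit and its single sub-problem share the name (CONVENTIONS §1), as in every Theorems file
set_option linter.dupNamespace false

namespace Summit.NavierStokesRegularity.NavierStokesRegularity.Theorems.PoloidalWindowDoorLrcModEntireTwistingTHFlatSliceNoGo

open MeasureTheory Set Function Filter Topology
open scoped RealInnerProductSpace InnerProductSpace
open Literature.Analysis Literature.Analysis.FluidPDE Literature.Analysis.UnboundedOperators
open Summit.NavierStokesRegularity.NavierStokesRegularity.Theorems.PoloidalWindowDoorLrcModEntireTwistingTHFlatSlicePressure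

/-- Integration along the vertical axis: if `f` is differentiable and `(∇f(y))₂ = c` at every `y`, then `f(R e₂) − f(0) = c R`. -/
theorem apply_sub_apply_of_gradient_two {f : EuclideanSpace ℝ (Fin 3) → ℝ} (hf : Differentiable ℝ f) {c : ℝ}
    (hc : ∀ y, gradient f y 2 = c) (R : ℝ) :
    f (R • EuclideanSpace.single (2 : Fin 3) (1 : ℝ)) - f 0 = c * R := by
  set e : EuclideanSpace ℝ (Fin 3) := EuclideanSpace.single (2 : Fin 3) (1 : ℝ) with he
  -- the line `r ↦ f (r e)` has constant derivative `c`
  have hderiv : ∀ r : ℝ, HasDerivAt (fun r : ℝ => f (r • e)) c r := by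
    intro r
    have hl : HasDerivAt (fun r : ℝ => r • e) e r := by simpa using (hasDerivAt_id r).smul_const e
    have h := (hf (r • e)).hasFDerivAt.comp_hasDerivAt r hl
    have hval : fderiv ℝ f (r • e) e = c := by
      have h1 : fderiv ℝ f (r • e) e = ⟪gradient f (r • e), e⟫_ℝ := by
        rw [gradient, InnerProductSpace.toDual_symm_apply]
      rw [h1, he, EuclideanSpace.inner_single_right]
      simp only [one_mul, conj_trivial]
      exact hc _
    rw [hval] at h
    exact h
  -- `r ↦ f (r e) − c r` has zero derivative, hence is constant
  have hg : ∀ r : ℝ, HasDerivAt (fun r : ℝ => f (r • e) - c * r) 0 r := by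
    intro r
    have h := (hderiv r).fun_sub ((hasDerivAt_id' r).const_mul c)
    rw [show (0 : ℝ) = c - c * 1 by ring]
    exact h
  have hconst := is_const_of_deriv_eq_zero (fun r => (hg r).differentiableAt) (fun r => (hg r).deriv) R 0
  simp only [zero_smul, mul_zero, sub_zero] at hconst
  linarith

/-- **NO FLAT HOT SLICE (modulo (F2)).**  `MildAncientPressureLogGrowth` ∧ route class ∧ `v₂(−1,0) ≠ 0` ∧ `√(−t)|v₂(t,x)| ≤ |v₂(−1,0)|` ∧ `v₂(−1,·) ≡ v₂(−1,0)`
⇒ `False`: the pressure would drop linearly, `P(−1, R e₂) − P(−1, 0) = −v₂(−1,0) R / 2` (`exists_linearPressure_of_flatSlice`, `apply_sub_apply_of_gradient_two`),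
against `|P(−1,x) − P(−1,0)| ≤ K(1 + log(1 + |x|))`. -/
theorem false_of_flatSlice (hF2 : MildAncientPressureLogGrowth) {C : ℝ} {v : ℝ → EuclideanSpace ℝ (Fin 3) → EuclideanSpace ℝ (Fin 3)}
    (hrate : HasTypeITimeDecay C v)
    (hcont : ContinuousOn (uncurry v) (Iio (0 : ℝ) ×ˢ univ))
    (hmild : ∀ s t : ℝ, s < t → t < 0 → ∀ x, v t x = heatExtension (v s) (t - s) x - oseenDuhamel 1 s v v t x)
    (hdiv : ∀ t < 0, VectorCalculus.IsDivFree (v t))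
    (hne : v (-1) 0 2 ≠ 0) (hhot : ∀ t < 0, ∀ x, Real.sqrt (-t) * |v t x 2| ≤ |v (-1) 0 2|)
    (hflat : ∀ x, v (-1) x 2 = v (-1) 0 2) : False := by
  obtain ⟨P, hP, hgrad⟩ := exists_linearPressure_of_flatSlice hrate hcont hmild hdiv hne hhot hflat
  obtain ⟨K, hK⟩ := hF2 C v P hrate hcont hmild hdiv hP (-1) (by norm_num)
  set N := v (-1) 0 2 with hN
  -- the pressure slice is differentiable
  have hPd : Differentiable ℝ (P (-1)) :=
    (IsSmoothSpaceTimeOn.contDiff_slice (S := Iio 0) (w := P) hP.smooth_pressure (by norm_num : (-1 : ℝ) < 0)).differentiable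
      (by simp)
  have hlin : ∀ R : ℝ, P (-1) (R • EuclideanSpace.single (2 : Fin 3) (1 : ℝ)) - P (-1) 0 = -N / 2 * R :=
    apply_sub_apply_of_gradient_two hPd hgrad
  -- `|N| R / 2 ≤ K (1 + log (1 + R))` for all `R ≥ 0`
  have hbound : ∀ R : ℝ, 0 ≤ R → |N| / 2 * R ≤ K * (1 + Real.log (1 + R)) := by
    intro R hR
    have h := hK (R • EuclideanSpace.single (2 : Fin 3) (1 : ℝ))
    rw [hlin R] at h
    have hnorm : ‖R • EuclideanSpace.single (2 : Fin 3) (1 : ℝ)‖ = R := by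
      simp [norm_smul, abs_of_nonneg hR]
    rw [hnorm] at h
    have habs : |-N / 2 * R| = |N| / 2 * R := by
      rw [abs_mul, abs_of_nonneg hR, abs_div, abs_neg, abs_two]
    linarith [habs ▸ h]
  -- contradiction for large `R`: `log (1 + R) ≤ 2 √(1 + R)` grows slower than `R`
  have hNpos : 0 < |N| := abs_pos.2 hne
  have hK0 : 0 ≤ K := by
    have h := hbound 0 le_rfl
    simp at h
    linarith
  -- take `R = 64 (1 + K/|N|)² − 1 ≥ 0`-free route: use `log x ≤ x^(1/2) / (1/2)` at `x = 1 + R`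
  have key : ∀ R : ℝ, 0 ≤ R → |N| / 2 * R ≤ K * (1 + 2 * Real.sqrt (1 + R)) := by
    intro R hR
    have h1 : Real.log (1 + R) ≤ 2 * Real.sqrt (1 + R) := by
      have h := Real.log_le_rpow_div (x := 1 + R) (by linarith) (ε := 1 / 2) (by norm_num)
      rw [Real.sqrt_eq_rpow]
      have : (1 + R) ^ (1 / 2 : ℝ) / (1 / 2 : ℝ) = 2 * (1 + R) ^ (1 / 2 : ℝ) := by ring
      linarith [this ▸ h]
    have h2 := hbound R hR
    nlinarith [h1, hK0]
  -- choose `R = 4 s²  - 1` with `s = √(1+R)` large: set `s := 8 (K + 1) / |N| + 1`, `R := s² − 1`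
  set s : ℝ := 16 * (K + 1) / |N| + 1 with hs
  have hs1 : 1 ≤ s := by
    rw [hs]; have : 0 ≤ 16 * (K + 1) / |N| := by positivity
    linarith
  have hRnn : 0 ≤ s ^ 2 - 1 := by nlinarith
  have hsq : Real.sqrt (1 + (s ^ 2 - 1)) = s := by
    rw [show 1 + (s ^ 2 - 1) = s ^ 2 by ring, Real.sqrt_sq (by linarith)]
  have h := key (s ^ 2 - 1) hRnn
  rw [hsq] at h
  -- `|N|/2 (s² − 1) ≤ K (1 + 2 s)` with `s ≥ 16(K+1)/|N| + 1` is absurd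
  have hNs : |N| * s = 16 * (K + 1) + |N| := by
    rw [hs]; field_simp
  nlinarith [hNs, hNpos, hK0, hs1, mul_pos hNpos (lt_of_lt_of_le one_pos hs1)]

end Summit.NavierStokesRegularity.NavierStokesRegularity.Theorems.PoloidalWindowDoorLrcModEntireTwistingTHFlatSliceNoGo
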